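import Mathlib
import HarnessLib
import Summits.AtomisticToContinuum.Crystallization.Theorems.PricedLinkCensusSoftFourRingsThreeTriQuad

/-!
# The bond pattern of a link neighbourhood is a subgraph of a 4-cycle

Route `PricedLinkCensus`, item `SoftFourRings` (stmt-AtomisticToContinuum-14234), evidence
`softrings-search.md` §5/§11.  For a site direction `v` with four link-neighbour directions
`w₀, …, w₃` in the angular window, the neighbours acquire cyclic positions `q k : Fin 4` (their
order around `v` in the tangent circle) and a bond `w_i ∼ w_j` forces the positions to be cyclically
adjacent (`q j = q i + 1` or `q i = q j + 1`): the bond graph induced on the four neighbours is a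
subgraph of the 4-cycle of positions (`link_bonds_cyclic`).  Purely combinatorial corollaries: no
neighbour is bonded to the three others (`no_link_claw`), and no three neighbours are pairwise bonded
(`no_link_triangle` — the soft link graph is `K₄`-free).  Together with `no_bonded_four_cycle` (A),
`no_three_triangles_quad` (B) and `fan_coherence` (C1) this is the complete local vertex structure a
rotation-system / Euler layer would consume.
-/

namespace Summit.AtomisticToContinuum.Crystallization.Theorems

open Real RealInnerProductSpace

/-- **Bonds join cyclically adjacent positions (circle form).**  Four angles `θ k ∈ (−π, π]`,
pairwise separated (`cos (θ i − θ j) ≤ cos g₀`, `π/3 < g₀`, `2g₀ ≤ π`), and `0 ≤ g₁ < 2 g₀`: there is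
an injective position map `q : Fin 4 → Fin 4` such that `cos g₁ ≤ cos (θ j − θ i)` with `i ≠ j`
forces `q j = q i + 1 ∨ q i = q j + 1`. [folklore] -/
theorem circle_bonds_cyclic {g₀ g₁ : ℝ} (hg₀ : π / 3 < g₀) (h2g₀ : 2 * g₀ ≤ π) (hg₁0 : 0 ≤ g₁)
    (hg₁₀ : g₁ < 2 * g₀) (θ : Fin 4 → ℝ) (hθ : ∀ k, -π < θ k ∧ θ k ≤ π)
    (hsep : ∀ i j, i ≠ j → cos (θ i - θ j) ≤ cos g₀) :
    ∃ q : Fin 4 → Fin 4, Function.Injective q ∧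
      ∀ i j, i ≠ j → cos g₁ ≤ cos (θ j - θ i) → (q j = q i + 1 ∨ q i = q j + 1) := by
  -- the angles are pairwise distinct
  have hcos1 : cos g₀ < 1 := by
    have := cos_lt_cos_of_nonneg_of_le_pi (le_refl 0) (by linarith) (by linarith : (0 : ℝ) < g₀)
    rwa [cos_zero] at this
  have hθinj : Function.Injective θ := by
    intro i j hij
    by_contra hne
    have := hsep i j hne
    rw [hij, sub_self, cos_zero] at this
    linarith
  -- sort
  have hAcard : (Finset.univ.image θ).card = 4 := by
    rw [Finset.card_image_of_injective _ hθinj, Finset.card_univ, Fintype.card_fin]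
  let e := (Finset.univ.image θ).orderEmbOfFin hAcard
  have hmem : ∀ i, ∃ k, e k = θ i := by
    intro i
    have hi : θ i ∈ Set.range e := by
      rw [Finset.range_orderEmbOfFin, Finset.coe_image]
      exact ⟨i, by simp, rfl⟩
    exact hi
  choose q hq using hmem
  have hqinj : Function.Injective q := by
    intro a b hab
    apply hθinj
    rw [← hq a, ← hq b, hab]
  have hmem' : ∀ k, ∃ i, θ i = e k := by
    intro k
    have := (Finset.univ.image θ).orderEmbOfFin_mem hAcard k
    rw [Finset.mem_image] at this
    obtain ⟨i, -, hi⟩ := this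
    exact ⟨i, hi⟩
  -- gaps of the sorted angles
  have hlo : -π < e 0 := by
    obtain ⟨i, hi⟩ := hmem' 0
    rw [← hi]; exact (hθ i).1
  have hhi : e 3 ≤ π := by
    obtain ⟨i, hi⟩ := hmem' 3
    rw [← hi]; exact (hθ i).2
  have hsep' : ∀ a b, a ≠ b → cos (e a - e b) ≤ cos g₀ := by
    intro a b hab
    obtain ⟨i, hi⟩ := hmem' a
    obtain ⟨j, hj⟩ := hmem' b
    have hne : i ≠ j := by
      rintro rfl
      exact hab (e.injective (hi.symm.trans hj))
    rw [← hi, ← hj]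
    exact hsep i j hne
  obtain ⟨-, -, -, -, hd02, hd13⟩ :=
    four_sorted_gaps hg₀ h2g₀ (fun k => e k) e.strictMono hlo hhi hsep'
  have hcos2 : cos (2 * g₀) < cos g₁ := cos_lt_cos_of_nonneg_of_le_pi hg₁0 h2g₀ hg₁₀
  have nb02 : ¬ cos g₁ ≤ cos (e 2 - e 0) := fun h => by linarith
  have nb20 : ¬ cos g₁ ≤ cos (e 0 - e 2) := fun h => by rw [cos_sub_rev] at h; linarith
  have nb13 : ¬ cos g₁ ≤ cos (e 3 - e 1) := fun h => by linarith
  have nb31 : ¬ cos g₁ ≤ cos (e 1 - e 3) := fun h => by rw [cos_sub_rev] at h; linarith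
  refine ⟨q, hqinj, fun i j hij hb => ?_⟩
  rw [← hq i, ← hq j] at hb
  rcases fin_four_adj_or_diag (q i) (q j) (hqinj.ne hij) with h' | ⟨h1, h2⟩ | ⟨h1, h2⟩ |
    ⟨h1, h2⟩ | ⟨h1, h2⟩
  · exact h'
  all_goals rw [h1, h2] at hb
  · exact absurd hb nb02
  · exact absurd hb nb20
  · exact absurd hb nb13
  · exact absurd hb nb31

/-- **Bonds of a link neighbourhood join cyclically adjacent positions** (unit-vector form,
general constants as in `no_three_triangles_quad` / `fan_coherence`).  If unit vectors
`v, w₀, …, w₃` of `ℝ³` satisfy `cb ≤ ⟪v, w k⟫ ≤ ca` and `⟪w i, w j⟫ ≤ ca` (`i ≠ j`), then there are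
injective positions `q : Fin 4 → Fin 4` such that every bond `cb ≤ ⟪w i, w j⟫` (`i ≠ j`) has
`q j = q i + 1 ∨ q i = q j + 1`. [folklore] -/
theorem link_bonds_cyclic {ca cb K : ℝ} (hcb0 : 0 < cb) (hcba : cb ≤ ca) (hca1 : ca < 1)
    (hsq : ca ^ 2 < cb) (hK : K * (1 - ca ^ 2) = cb - ca ^ 2)
    (hKs : K ^ 2 * ca ^ 2 * (1 - cb ^ 2) ≤ cb ^ 2 * (1 - ca ^ 2))
    (hσ : (ca - cb ^ 2) / (1 - ca ^ 2) < 1 / 2)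
    (hσK : 2 * ((ca - cb ^ 2) / (1 - ca ^ 2)) ^ 2 - 1 < K)
    {v : EuclideanSpace ℝ (Fin 3)} (hv : ‖v‖ = 1) (w : Fin 4 → EuclideanSpace ℝ (Fin 3))
    (hw : ∀ k, ‖w k‖ = 1) (hvw : ∀ k, cb ≤ ⟪v, w k⟫ ∧ ⟪v, w k⟫ ≤ ca)
    (hsep : ∀ i j, i ≠ j → ⟪w i, w j⟫ ≤ ca) :
    ∃ q : Fin 4 → Fin 4, Function.Injective q ∧
      ∀ i j, i ≠ j → cb ≤ ⟪w i, w j⟫ → (q j = q i + 1 ∨ q i = q j + 1) := by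
  set σ₁ := (ca - cb ^ 2) / (1 - ca ^ 2) with hσ₁
  have hca0 : 0 < ca := hcb0.trans_le hcba
  have h1ca : 0 < 1 - ca ^ 2 := by nlinarith
  have hσ0 : 0 ≤ σ₁ := div_nonneg (by nlinarith) h1ca.le
  have hK0 : 0 < K := by
    by_contra h
    have h' : K ≤ 0 := not_lt.mp h
    have := mul_le_mul_of_nonneg_right h' h1ca.le
    rw [hK, zero_mul] at this
    linarith
  have hK1 : K ≤ 1 := by
    by_contra h
    have h' : 1 < K := not_le.mp h
    have := mul_lt_mul_of_pos_right h' h1ca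
    rw [hK, one_mul] at this
    linarith
  obtain ⟨ρ, θ, hρ0, hρsq, hθ, hinner⟩ := tangent_polar hv w hw
  have hcb_le : ∀ k, cb ≤ ⟪v, w k⟫ := fun k => (hvw k).1
  have hc_le : ∀ k, ⟪v, w k⟫ ≤ ca := fun k => (hvw k).2
  have hc0 : ∀ k, 0 ≤ ⟪v, w k⟫ := fun k => hcb0.le.trans (hcb_le k)
  have hρρlo : ∀ i j, 1 - ca ^ 2 ≤ ρ i * ρ j := by
    intro i j
    have hi : 1 - ca ^ 2 ≤ ρ i ^ 2 := by rw [hρsq]; nlinarith [hc_le i, hc0 i]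
    have hj : 1 - ca ^ 2 ≤ ρ j ^ 2 := by rw [hρsq]; nlinarith [hc_le j, hc0 j]
    have hsq2 : (1 - ca ^ 2) ^ 2 ≤ (ρ i * ρ j) ^ 2 := by
      rw [mul_pow, sq (1 - ca ^ 2)]; exact mul_le_mul hi hj h1ca.le (sq_nonneg _)
    exact (pow_le_pow_iff_left₀ h1ca.le (mul_nonneg (hρ0 _) (hρ0 _)) two_ne_zero).1 hsq2
  have hsepθ : ∀ i j, i ≠ j → cos (θ i - θ j) ≤ σ₁ := by
    intro i j hij
    have h := hsep i j hij
    rw [hinner] at h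
    have hcc : cb ^ 2 ≤ ⟪v, w i⟫ * ⟪v, w j⟫ := by nlinarith [hcb_le i, hcb_le j, hcb0]
    have hKK : ρ i * ρ j * cos (θ i - θ j) ≤ ca - cb ^ 2 := by linarith
    rcases le_or_gt (cos (θ i - θ j)) 0 with hneg | hpos
    · exact hneg.trans hσ0
    · rw [hσ₁, le_div_iff₀ h1ca]
      calc cos (θ i - θ j) * (1 - ca ^ 2) ≤ cos (θ i - θ j) * (ρ i * ρ j) :=
            mul_le_mul_of_nonneg_left (hρρlo i j) hpos.le
        _ ≤ ca - cb ^ 2 := by linarith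
  have hbondθ : ∀ i j, cb ≤ ⟪w i, w j⟫ → K ≤ cos (θ i - θ j) := by
    intro i j hbd
    rw [hinner, add_comm] at hbd
    exact corner_cos_lower hcb0 hca1 hsq hK hKs (hcb_le i) (hc_le i) (hc_le j) (hρ0 _) (hρsq i)
      (hρ0 _) (hρsq j) hbd
  set g₀ := arccos σ₁ with hg₀
  set g₁ := arccos K with hg₁
  have hσ1 : σ₁ ≤ 1 := by linarith
  have hcg₀ : cos g₀ = σ₁ := cos_arccos (by linarith) hσ1
  have hcg₁ : cos g₁ = K := cos_arccos (by linarith) hK1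
  have hπ3 : π / 3 < g₀ := by
    have : arccos (1 / 2) = π / 3 :=
      arccos_eq_of_eq_cos (by positivity) (by linarith [pi_pos]) cos_pi_div_three.symm
    rw [hg₀, ← this]
    exact arccos_lt_arccos (by linarith) hσ (by norm_num)
  have h2g₀ : 2 * g₀ ≤ π := by
    have := arccos_le_pi_div_two.2 hσ0
    rw [← hg₀] at this; linarith
  have hg₁0 : 0 ≤ g₁ := arccos_nonneg K
  have hg₁π : g₁ ≤ π := arccos_le_pi K
  have hg₁₀ : g₁ < 2 * g₀ := by
    by_contra h
    have h' : 2 * g₀ ≤ g₁ := not_lt.mp h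
    have := cos_le_cos_of_nonneg_of_le_pi (by linarith [arccos_nonneg σ₁]) hg₁π h'
    rw [hcg₁, cos_two_mul, hcg₀] at this
    linarith
  obtain ⟨q, hqinj, hq⟩ := circle_bonds_cyclic hπ3 h2g₀ hg₁0 hg₁₀ θ hθ (fun i j hij => by
    rw [hcg₀]; exact hsepθ i j hij)
  refine ⟨q, hqinj, fun i j hij hbd => hq i j hij ?_⟩
  rw [hcg₁, cos_sub_rev]; exact hbondθ i j hbd

/-- **No claw in a link neighbourhood**: under the hypotheses of `link_bonds_cyclic`, `w₀` is not
bonded to all of `w₁, w₂, w₃` (a position on a 4-cycle has only two neighbours). [folklore] -/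
theorem no_link_claw {ca cb K : ℝ} (hcb0 : 0 < cb) (hcba : cb ≤ ca) (hca1 : ca < 1)
    (hsq : ca ^ 2 < cb) (hK : K * (1 - ca ^ 2) = cb - ca ^ 2)
    (hKs : K ^ 2 * ca ^ 2 * (1 - cb ^ 2) ≤ cb ^ 2 * (1 - ca ^ 2))
    (hσ : (ca - cb ^ 2) / (1 - ca ^ 2) < 1 / 2)
    (hσK : 2 * ((ca - cb ^ 2) / (1 - ca ^ 2)) ^ 2 - 1 < K)
    {v : EuclideanSpace ℝ (Fin 3)} (hv : ‖v‖ = 1) (w : Fin 4 → EuclideanSpace ℝ (Fin 3))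
    (hw : ∀ k, ‖w k‖ = 1) (hvw : ∀ k, cb ≤ ⟪v, w k⟫ ∧ ⟪v, w k⟫ ≤ ca)
    (hsep : ∀ i j, i ≠ j → ⟪w i, w j⟫ ≤ ca) (h01 : cb ≤ ⟪w 0, w 1⟫) (h02 : cb ≤ ⟪w 0, w 2⟫)
    (h03 : cb ≤ ⟪w 0, w 3⟫) : False := by
  obtain ⟨q, hqinj, hq⟩ :=
    link_bonds_cyclic hcb0 hcba hca1 hsq hK hKs hσ hσK hv w hw hvw hsep
  have step : ∀ i j, (q j = q i + 1 ∨ q i = q j + 1) → (q j - q i = 1 ∨ q j - q i = 3) := by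
    intro i j h
    rcases h with h | h
    · left; rw [h]
      have : ∀ a : Fin 4, a + 1 - a = 1 := by decide
      exact this _
    · right; rw [h]
      have : ∀ a : Fin 4, a - (a + 1) = 3 := by decide
      exact this _
  have d1 := step 0 1 (hq 0 1 (by decide) h01)
  have d2 := step 0 2 (hq 0 2 (by decide) h02)
  have d3 := step 0 3 (hq 0 3 (by decide) h03)
  have n12 : q 1 - q 0 ≠ q 2 - q 0 := fun h => by
    have := sub_left_injective h; exact absurd (hqinj this) (by decide)
  have n13 : q 1 - q 0 ≠ q 3 - q 0 := fun h => by
    have := sub_left_injective h; exact absurd (hqinj this) (by decide)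
  have n23 : q 2 - q 0 ≠ q 3 - q 0 := fun h => by
    have := sub_left_injective h; exact absurd (hqinj this) (by decide)
  have key : ∀ x y z : Fin 4, (x = 1 ∨ x = 3) → (y = 1 ∨ y = 3) → (z = 1 ∨ z = 3) → x ≠ y →
      x ≠ z → y ≠ z → False := by decide
  exact key _ _ _ d1 d2 d3 n12 n13 n23

/-- **No triangle in a link neighbourhood** (the soft link graph is `K₄`-free): under the
hypotheses of `link_bonds_cyclic`, `w₀, w₁, w₂` are not pairwise bonded (three steps of `±1`
cannot sum to `0` in `ℤ/4`). [folklore] -/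
theorem no_link_triangle {ca cb K : ℝ} (hcb0 : 0 < cb) (hcba : cb ≤ ca) (hca1 : ca < 1)
    (hsq : ca ^ 2 < cb) (hK : K * (1 - ca ^ 2) = cb - ca ^ 2)
    (hKs : K ^ 2 * ca ^ 2 * (1 - cb ^ 2) ≤ cb ^ 2 * (1 - ca ^ 2))
    (hσ : (ca - cb ^ 2) / (1 - ca ^ 2) < 1 / 2)
    (hσK : 2 * ((ca - cb ^ 2) / (1 - ca ^ 2)) ^ 2 - 1 < K)
    {v : EuclideanSpace ℝ (Fin 3)} (hv : ‖v‖ = 1) (w : Fin 4 → EuclideanSpace ℝ (Fin 3))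
    (hw : ∀ k, ‖w k‖ = 1) (hvw : ∀ k, cb ≤ ⟪v, w k⟫ ∧ ⟪v, w k⟫ ≤ ca)
    (hsep : ∀ i j, i ≠ j → ⟪w i, w j⟫ ≤ ca) (h01 : cb ≤ ⟪w 0, w 1⟫) (h12 : cb ≤ ⟪w 1, w 2⟫)
    (h20 : cb ≤ ⟪w 2, w 0⟫) : False := by
  obtain ⟨q, -, hq⟩ :=
    link_bonds_cyclic hcb0 hcba hca1 hsq hK hKs hσ hσK hv w hw hvw hsep
  have step : ∀ i j, (q j = q i + 1 ∨ q i = q j + 1) → (q j - q i = 1 ∨ q j - q i = 3) := by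
    intro i j h
    rcases h with h | h
    · left; rw [h]
      have : ∀ a : Fin 4, a + 1 - a = 1 := by decide
      exact this _
    · right; rw [h]
      have : ∀ a : Fin 4, a - (a + 1) = 3 := by decide
      exact this _
  have d1 := step 0 1 (hq 0 1 (by decide) h01)
  have d2 := step 1 2 (hq 1 2 (by decide) h12)
  have d3 := step 2 0 (hq 2 0 (by decide) h20)
  have hsum : (q 1 - q 0) + (q 2 - q 1) + (q 0 - q 2) = 0 := by
    have : ∀ a b c : Fin 4, (b - a) + (c - b) + (a - c) = 0 := by decide
    exact this _ _ _
  have key : ∀ x y z : Fin 4, (x = 1 ∨ x = 3) → (y = 1 ∨ y = 3) → (z = 1 ∨ z = 3) →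
      x + y + z ≠ 0 := by decide
  exact key _ _ _ d1 d2 d3 hsum

/-- **`η = 1/100` instances**: no claw and no triangle among the four link-neighbour directions of
a site direction, in the angular window of `softFourRings_of_twelve_unit`. [folklore] -/
theorem no_link_claw_one_percent {v : EuclideanSpace ℝ (Fin 3)} (hv : ‖v‖ = 1)
    (w : Fin 4 → EuclideanSpace ℝ (Fin 3)) (hw : ∀ k, ‖w k‖ = 1)
    (hvw : ∀ k, (1 - (101 / 100 : ℝ) ^ 2 / 2) ≤ ⟪v, w k⟫ ∧
      ⟪v, w k⟫ ≤ 1 - 1 / (2 * (101 / 100 : ℝ) ^ 2))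
    (hsep : ∀ i j, i ≠ j → ⟪w i, w j⟫ ≤ 1 - 1 / (2 * (101 / 100 : ℝ) ^ 2))
    (h01 : (1 - (101 / 100 : ℝ) ^ 2 / 2) ≤ ⟪w 0, w 1⟫)
    (h02 : (1 - (101 / 100 : ℝ) ^ 2 / 2) ≤ ⟪w 0, w 2⟫)
    (h03 : (1 - (101 / 100 : ℝ) ^ 2 / 2) ≤ ⟪w 0, w 3⟫) : False :=
  no_link_claw (ca := 1 - 1 / (2 * (101 / 100 : ℝ) ^ 2)) (cb := 1 - (101 / 100 : ℝ) ^ 2 / 2)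
    (K := 478679849399 / 1540200000000) (by norm_num) (by norm_num) (by norm_num) (by norm_num)
    (by norm_num) (by norm_num) (by norm_num) (by norm_num) hv w hw hvw hsep h01 h02 h03

/-- See `no_link_claw_one_percent`; triangle version. [folklore] -/
theorem no_link_triangle_one_percent {v : EuclideanSpace ℝ (Fin 3)} (hv : ‖v‖ = 1)
    (w : Fin 4 → EuclideanSpace ℝ (Fin 3)) (hw : ∀ k, ‖w k‖ = 1)
    (hvw : ∀ k, (1 - (101 / 100 : ℝ) ^ 2 / 2) ≤ ⟪v, w k⟫ ∧
      ⟪v, w k⟫ ≤ 1 - 1 / (2 * (101 / 100 : ℝ) ^ 2))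
    (hsep : ∀ i j, i ≠ j → ⟪w i, w j⟫ ≤ 1 - 1 / (2 * (101 / 100 : ℝ) ^ 2))
    (h01 : (1 - (101 / 100 : ℝ) ^ 2 / 2) ≤ ⟪w 0, w 1⟫)
    (h12 : (1 - (101 / 100 : ℝ) ^ 2 / 2) ≤ ⟪w 1, w 2⟫)
    (h20 : (1 - (101 / 100 : ℝ) ^ 2 / 2) ≤ ⟪w 2, w 0⟫) : False :=
  no_link_triangle (ca := 1 - 1 / (2 * (101 / 100 : ℝ) ^ 2)) (cb := 1 - (101 / 100 : ℝ) ^ 2 / 2)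
    (K := 478679849399 / 1540200000000) (by norm_num) (by norm_num) (by norm_num) (by norm_num)
    (by norm_num) (by norm_num) (by norm_num) (by norm_num) hv w hw hvw hsep h01 h12 h20

end Summit.AtomisticToContinuum.Crystallization.Theorems
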